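import Summits.CriticalPhenomena.PercolationContinuityZ3.Theorems.PercNearOneGluingNoHeavyLowerTailAntiBandFrameCriterion
import Summits.CriticalPhenomena.PercolationContinuityZ3.Theorems.PercNearOneGluingNoHeavyLowerTailAntiBandShiftReduction

/-!
# `NoHeavyLowerTail` (crux stmt-CriticalPhenomena-4575), lane prim-ineq-gen-4 (gen 22): FRAME ⇒ (AB_l) on `Fin n` (bridge)

Support file (`--supports stmt-CriticalPhenomena-4575`; memo `run/shared/lean/prim/prim-ineq-gen-4/FINDING-FRAMES-g22.md` §1, §5).
No definitions, no `sorry`, standard axioms.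

Combines the frame criterion (`AntiBandFrameCriterion.det_submatrix_ne_zero_of_frame`, gen 22) with the determinant criterion in its
shifted form (`AntiBandShiftReduction.antiBand_of_forall_shifted_det_ne_zero`, gen 21): if the ball `{x : Finset (Fin n) // #x < l}` carries a
frame `w` — vectors `w x` supported on the supersets of `x`, `w x x ≠ 0`, with the quadratic form of `M x x' = C(n − 1 − #(x ∪ x'), l − 1)`
positive on the non-zero frame vectors with coefficients on the sets of size `≡ l − 1 (mod 2)` and negative on those with coefficients on the
other sizes — then the anti-band inequality (AB_l) holds for EVERY pair of upper sets of `Finset (Fin n)`.  For (n, l−1) with l ≤ 5 such frames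
exist for all n ≥ 2l (memo §3–§4: explicit for n ≥ n₀(l−1), exact rational certificates below), so this file reduces (AB_4), (AB_5) on `Fin n` to
the definiteness of two explicit rational Gram matrices per n (checked outside the kernel, memo §2, §4).
-/

namespace Summit.CriticalPhenomena.PercolationContinuityZ3.Theorems.AntiBandFrameBridge

open Finset Matrix
open scoped FinsetFamily

/-- **Frame ⇒ (AB_l).**  On `Fin n` with `1 ≤ l`, `2l ≤ n`: a frame for the binomial matrix on the ball `{x // #x < l}` (in the sense of
`AntiBandFrameCriterion.det_submatrix_ne_zero_of_frame`, positive class = sizes of the parity of `l − 1`) gives the anti-band inequality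
`#{s ∈ A ∩ Bᶜˢ | #s < l ∨ #sᶜ < l} ≤ #{s ∈ A ∩ B | #s < l ∨ #sᶜ < l}` for all upper sets `A, B`. [gen 22, FINDING-FRAMES-g22.md §1/§5] -/
theorem antiBand_of_frame {n : ℕ} (l : ℕ) (hl : 1 ≤ l) (h2l : 2 * l ≤ n)
    (w : {x : Finset (Fin n) // #x < l} → {x : Finset (Fin n) // #x < l} → ℚ)
    (hsupp : ∀ x y, w x y ≠ 0 → x ≤ y) (hdiag : ∀ x, w x x ≠ 0)
    (hpos : ∀ a : {x : Finset (Fin n) // #x < l} → ℚ,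
      (∀ x : {x : Finset (Fin n) // #x < l}, ¬ (#x.1 % 2 = (l - 1) % 2) → a x = 0) → a ≠ 0 →
      0 < (fun y => ∑ x, a x * w x y) ⬝ᵥ
        ((Matrix.of fun (x x' : {x : Finset (Fin n) // #x < l}) =>
            ((n - 1 - #((x : Finset (Fin n)) ∪ x')).choose (l - 1) : ℚ)) *ᵥ fun y => ∑ x, a x * w x y))
    (hneg : ∀ a : {x : Finset (Fin n) // #x < l} → ℚ,
      (∀ x : {x : Finset (Fin n) // #x < l}, (#x.1 % 2 = (l - 1) % 2) → a x = 0) → a ≠ 0 →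
      (fun y => ∑ x, a x * w x y) ⬝ᵥ
        ((Matrix.of fun (x x' : {x : Finset (Fin n) // #x < l}) =>
            ((n - 1 - #((x : Finset (Fin n)) ∪ x')).choose (l - 1) : ℚ)) *ᵥ fun y => ∑ x, a x * w x y) < 0)
    (A B : Finset (Finset (Fin n))) (hA : IsUpperSet (A : Set (Finset (Fin n))))
    (hB : IsUpperSet (B : Set (Finset (Fin n)))) :
    #((A ∩ Bᶜˢ).filter fun s => #s < l ∨ #sᶜ < l) ≤ #((A ∩ B).filter fun s => #s < l ∨ #sᶜ < l) := by
  classical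
  -- the rational binomial matrix on the ball
  set M : Matrix {x : Finset (Fin n) // #x < l} {x : Finset (Fin n) // #x < l} ℚ :=
    Matrix.of fun x x' => ((n - 1 - #((x : Finset (Fin n)) ∪ x')).choose (l - 1) : ℚ) with hMdef
  have hMsymm : M.IsSymm := by
    ext x x'
    simp only [hMdef, transpose_apply, of_apply, union_comm]
  refine AntiBandShiftReduction.antiBand_of_forall_shifted_det_ne_zero l hl h2l ?_ A B hA hB
  intro A' hA' _
  -- the up-set of the ball cut out by A'
  set U : Finset {x : Finset (Fin n) // #x < l} := univ.filter fun x => (x : Finset (Fin n)) ∈ A' with hUdef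
  have hU : IsUpperSet (U : Set {x : Finset (Fin n) // #x < l}) := by
    intro x y hxy hx
    rw [Finset.mem_coe, hUdef, mem_filter] at hx ⊢
    exact ⟨mem_univ _, hA' (show (x : Finset (Fin n)) ≤ y from hxy) hx.2⟩
  have hdetQ := AntiBandFrameCriterion.det_submatrix_ne_zero_of_frame M hMsymm w hsupp hdiag
    (fun x => #x.1 % 2 = (l - 1) % 2) hpos hneg U hU
  -- transport along the equivalence between the two index types
  let e : ↥(A'.filter fun s => #s < l) ≃ ↥U :=
    { toFun := fun x => ⟨⟨(x : Finset (Fin n)), (mem_filter.1 x.2).2⟩, by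
        rw [hUdef, mem_filter]; exact ⟨mem_univ _, (mem_filter.1 x.2).1⟩⟩
      invFun := fun y => ⟨((y : {x : Finset (Fin n) // #x < l}) : Finset (Fin n)), by
        rw [mem_filter]
        have hy := Finset.mem_filter.1 y.2
        exact ⟨hy.2, (y : {x : Finset (Fin n) // #x < l}).2⟩⟩
      left_inv := fun x => by ext; rfl
      right_inv := fun y => by ext; rfl }
  intro hdetZ
  apply hdetQ
  -- the integer matrix, cast to ℚ and reindexed along `e`, is the rational submatrix
  have hcard : Fintype.card (Fin n) = n := Fintype.card_fin n
  have hmat : (M.submatrix (Subtype.val : ↥U → _) Subtype.val) =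
      ((Matrix.of fun (x x' : ↥(A'.filter fun s => #s < l)) =>
        ((Fintype.card (Fin n) - 1 - #((x : Finset (Fin n)) ∪ x')).choose (l - 1) : ℤ)).map (Int.castRingHom ℚ)).submatrix
          e.symm e.symm := by
    ext y y'
    simp only [submatrix_apply, map_apply, of_apply, hMdef, hcard, eq_intCast, Int.cast_natCast]
    rfl
  rw [hmat, Matrix.det_submatrix_equiv_self, ← RingHom.mapMatrix_apply, ← RingHom.map_det, hdetZ, map_zero]

end Summit.CriticalPhenomena.PercolationContinuityZ3.Theorems.AntiBandFrameBridge
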